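import Summits.ResolutionOfSingularities.ResolutionOfSingularities.Theorems.PurelyInseparableDim4ResConeCInfGameStepPrime
import Summits.ResolutionOfSingularities.ResolutionOfSingularities.Theorems.PurelyInseparableDim4NearDimConverse
import HarnessLib
import HarnessLib.Audit.Tags

/-!
# Purely inseparable four-folds — the TRANSLATED slot step of the light-pair power cone, every prime: the coefficient of a
# child monomial is the binomial (Hasse) sum along the parent LINE; the u-row FLAG is carried by EVERY slot step; the
# «♯-pinning» identity of the flagless branch (cell `res-dim4-pi`, K2(p) lane, power-cone light-pair line, FILE ♯1)

[OURS · counted 0 · cell `res-dim4-pi` · K2(p) lane (holder res-dim4-p-12 g5); seat res-dim4-p-3 g6 (MEMO «FLAGLESS♯», HOME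
`res-dim4-p-3/MEMO-g6-FLAGLESS-SHARP.md`, bus 2026-08-29 13:55Z).]  Nothing here proves K2(p) for any `p`, any TAIL(p, p−1, 3),
`NoIsolatedTrap p p`, the Cossart–Jannsen–Saito theorem or resolution of singularities in dimension ≥ 4 / characteristic `p` —
NOT proved.  AI kernel work, weaker than expert review.  Pure exponent algebra of OUR frame; kills nothing by itself.

THE STEP.  `s′ = CentreBlowup.step p univ j b s` with the translation `b = β·e_u` along the FREE letter `u` (`b j = 0`): chart `x_j`
of the point blow-up, then `x_u ↦ x_u + β`, then cleaning.  For a child exponent `γ + (m − p)·e_j` (`γ_j = 0`, `p ≤ m`) only the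
parent monomials of DEGREE `m` contribute, and after dehomogenisation `x_j := 1` the translation acts by the binomial theorem:
* §1 `coeff_add_single_pointTransform_univ_of_le` — res-dim4-p-3 g2's layer identity `…NearDimConverse.coeff_add_single_pointTransform_univ`
  WITHOUT the hypothesis «every monomial has degree ≥ m» (only `≥ p`): lower layers contribute `C(deg − p, m − p) = 0`.
* §2 `coeff_translate_line_u` — `coeff γ (F_m(x + b̂))`, `b̂ = (j ↦ 1, u ↦ β, else 0)`, is the LINE SUM
  `Σ_{δ : |δ| = m, δ_i = γ_i, δ_f = γ_f} C(δ_u, γ_u) β^{δ_u − γ_u} · coeff δ F` (the other slot `i` and the contact letter `f` are frozen,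
  `δ_j + δ_u` is constant on the line: res-dim4-typ-1 g5's «line polynomial» evaluated through its Hasse derivatives).
* §3 **`coeff_step_translate_u`** — the two combined: THE TRANSLATED-STEP COEFFICIENT FORMULA (for `β = 0` it is FILE 2's forward law).
* §4 **`coeff_flag_step_translate_u`** — under the exact pair ledger (`f`-degree `≤ d − 1 ⇒ j-exponent ≥ 2`) the u-row FLAG coefficient
  `x_j² x_i² x_u^{d−1−c′} x_f^{c′}` (`c′ + 2 ≤ d`) is carried IDENTICALLY by the translated step, for every `β`: its line has no member above
  it.  Consequence (MEMO (F2)): the flag vector of a light-pair chain is a chain invariant — a chain is flagged for ever or flagless for ever.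
* §5 **`coeff_sharp_step_translate_u`** — in «regime R» of the flagless branch (`f`-free monomials have `j`-exponent `≥ 3`) the child
  coefficient at `x_j³x_i³x_u^{d−3}` is `(d − 2)·β·g + g′` with `g = coeff x_j³x_i³x_u^{d−2}` (the ♯-flag `κ²o²u^{d−2}` of the residual) and
  `g′ = coeff x_j⁴x_i³x_u^{d−3}` (the cross monomial): when the child has no such degree-`(d+1)` residual monomial (LAYER) and the cross is
  dead, `(d − 2)·β·g = 0` — THE TRANSLATION IS PINNED BY `g ≠ 0` («VT-u♯», MEMO §3).
[cite: Hauser2010, §§F–G (chart expressions of a point blowup)] [cite: CossartJannsenSaito2020, Lemma 13.2]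
bears_on: LADDER-RESOLUTION:D157-DOOR2 (res-dim4-pi · K2(p) · power cones · flagless branch ♯1).  Supports
stmt-ResolutionOfSingularities-16155 (helper).
-/

set_option linter.dupNamespace false -- mandated namespace of this single-conjunct summit

noncomputable section

namespace Summit.ResolutionOfSingularities.ResolutionOfSingularities.Theorems.PIDim4

namespace ResCone

open MvPolynomial Finset
open Literature.AlgebraicGeometry.Resolution
open Literature.AlgebraicGeometry.Resolution.CentreBlowup
open Literature.AlgebraicGeometry.Resolution.Hauser2010
open Literature.AlgebraicGeometry.Resolution.HauserPerlega2019

variable {K : Type} [Field K]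

/-! ## 1. The layer identity, all layers -/

/-- **Layer identity, every layer** (`p ≤ m`; every monomial of `F` of degree `≥ p`; `b_j = 0`; `γ_j = 0`):
`coeff (γ + (m − p)·e_j) (pointTransform p univ j b s) = coeff γ (F_m(x + b̂))`, `b̂ = b` with `b̂_j := 1`.  Monomials of degree `> m`
meet `b_j^{>0} = 0`, those of degree `< m` meet `C(deg − p, m − p) = 0`. [OURS] [cite: Hauser2010, §F (chart expressions of a point blowup)] -/
theorem coeff_add_single_pointTransform_univ_of_le {p m : ℕ} (hpm : p ≤ m) (j : Fin 4) (b : Fin 4 → K) (hbj : b j = 0)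
    (s : State K) (hp : ∀ d ∈ s.F.support, p ≤ d.degree) (γ : Fin 4 →₀ ℕ) (hγ : γ j = 0) :
    coeff (γ + Finsupp.single j (m - p)) (pointTransform p Finset.univ j b s) =
      coeff γ (PointBlowup.translate (Function.update b j 1) (homogeneousComponent m s.F)) := by
  classical
  have hsum : pointTransform p Finset.univ j b s = ∑ d ∈ s.F.support,
      PointBlowup.translate b (monomial (chartExponent p Finset.univ j d) (coeff d s.F)) := by
    unfold pointTransform chartTransform PointBlowup.translate
    rw [map_sum]
  have hinit : PointBlowup.translate (Function.update b j 1) (homogeneousComponent m s.F) =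
      ∑ d ∈ s.F.support with d.degree = m,
        PointBlowup.translate (Function.update b j 1) (monomial d (coeff d s.F)) := by
    rw [homogeneousComponent_apply]
    unfold PointBlowup.translate
    rw [map_sum]
  rw [hsum, hinit, coeff_sum, coeff_sum, Finset.sum_filter]
  refine Finset.sum_congr rfl fun d hd => ?_
  rw [WeightedBlowup.coeff_translate_monomial, WeightedBlowup.coeff_translate_monomial,
    ← Finset.mul_prod_erase Finset.univ _ (Finset.mem_univ j),
    ← Finset.mul_prod_erase Finset.univ _ (Finset.mem_univ j)]
  have hrest : ∏ i ∈ Finset.univ.erase j,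
      (((chartExponent p Finset.univ j d i).choose ((γ + Finsupp.single j (m - p)) i) : K) *
        b i ^ (chartExponent p Finset.univ j d i - (γ + Finsupp.single j (m - p)) i)) =
      ∏ i ∈ Finset.univ.erase j, (((d i).choose (γ i) : K) *
        Function.update b j 1 i ^ (d i - γ i)) := by
    refine Finset.prod_congr rfl fun i hi => ?_
    have hij : i ≠ j := Finset.ne_of_mem_erase hi
    rw [chartExponent_apply_of_ne p _ hij, Finsupp.add_apply, Finsupp.single_eq_of_ne hij, add_zero,
      Function.update_of_ne hij]
  have hj1 : (((chartExponent p Finset.univ j d j).choose ((γ + Finsupp.single j (m - p)) j) : ℕ) : K) *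
      b j ^ (chartExponent p Finset.univ j d j - (γ + Finsupp.single j (m - p)) j) =
      if d.degree = m then 1 else 0 := by
    rw [chartExponent_apply_self, degIn_univ, Finsupp.add_apply, hγ, zero_add,
      Finsupp.single_eq_same, hbj]
    by_cases hdeg : d.degree = m
    · rw [if_pos hdeg, hdeg, Nat.choose_self, Nat.sub_self, pow_zero, Nat.cast_one, one_mul]
    · rw [if_neg hdeg]
      rcases Nat.lt_or_gt_of_ne hdeg with hlt | hgt
      · rw [Nat.choose_eq_zero_of_lt (by have := hp d hd; omega), Nat.cast_zero, zero_mul]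
      · rw [zero_pow (Nat.sub_ne_zero_of_lt (by omega)), mul_zero]
  have hj2 : (((d j).choose (γ j) : ℕ) : K) * Function.update b j 1 j ^ (d j - γ j) = 1 := by
    rw [hγ, Function.update_self, Nat.choose_zero_right, Nat.cast_one, one_pow, one_mul]
  rw [hrest, hj1, hj2, one_mul]
  split_ifs <;> simp

/-! ## 2. The line sum: translation along `u` of a dehomogenised layer -/

section Line

variable {j i u f : Fin 4} (hji : j ≠ i) (hju : j ≠ u) (hjf : j ≠ f) (hiu : i ≠ u) (hif : i ≠ f) (huf : u ≠ f)
include hji hju hjf hiu hif huf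

omit hif in
/-- The dehomogenising translation vector `b̂ = (j ↦ 1, u ↦ β, i ↦ 0, f ↦ 0)` read letter by letter. [OURS · bookkeeping] -/
theorem translateVec_apply (β : K) :
    Function.update (Function.update (0 : Fin 4 → K) u β) j 1 j = 1 ∧
      Function.update (Function.update (0 : Fin 4 → K) u β) j 1 u = β ∧
      Function.update (Function.update (0 : Fin 4 → K) u β) j 1 i = 0 ∧
      Function.update (Function.update (0 : Fin 4 → K) u β) j 1 f = 0 := by
  refine ⟨Function.update_self .., ?_, ?_, ?_⟩
  · rw [Function.update_of_ne hju.symm, Function.update_self]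
  · rw [Function.update_of_ne hji.symm, Function.update_of_ne hiu]; rfl
  · rw [Function.update_of_ne hjf.symm, Function.update_of_ne huf.symm]; rfl

/-- **The line sum**: `coeff γ (F_m(x + b̂))` for `b̂ = (j ↦ 1, u ↦ β, else 0)` and `γ_j = 0` is
`Σ_{δ ∈ supp F : |δ| = m, δ_i = γ_i, δ_f = γ_f} C(δ_u, γ_u)·β^{δ_u−γ_u}·coeff δ F` — the other slot and the contact letter are frozen
(`0^{>0} = 0`, `C(n, k) = 0` for `n < k`), `x_j := 1` contributes `C(δ_j, 0) = 1`. [OURS] [folklore] -/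
theorem coeff_translate_line_u (β : K) (F : MvPolynomial (Fin 4) K) (m : ℕ) (γ : Fin 4 →₀ ℕ) (hγ : γ j = 0) :
    coeff γ (PointBlowup.translate (Function.update (Function.update (0 : Fin 4 → K) u β) j 1)
        (homogeneousComponent m F)) =
      ∑ δ ∈ F.support with (δ.degree = m ∧ δ i = γ i ∧ δ f = γ f),
        ((δ u).choose (γ u) : K) * β ^ (δ u - γ u) * coeff δ F := by
  classical
  obtain ⟨hbj, hbu, hbi, hbf⟩ := translateVec_apply hji hju hjf hiu huf β
  set bh : Fin 4 → K := Function.update (Function.update (0 : Fin 4 → K) u β) j 1 with hbh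
  have hinit : PointBlowup.translate bh (homogeneousComponent m F) =
      ∑ d ∈ F.support with d.degree = m, PointBlowup.translate bh (monomial d (coeff d F)) := by
    rw [homogeneousComponent_apply]
    unfold PointBlowup.translate
    rw [map_sum]
  rw [hinit, coeff_sum, Finset.sum_filter, Finset.sum_filter]
  refine Finset.sum_congr rfl fun δ _ => ?_
  by_cases hdeg : δ.degree = m
  · rw [if_pos hdeg, WeightedBlowup.coeff_translate_monomial]
    by_cases hδi : δ i = γ i
    · by_cases hδf : δ f = γ f
      · rw [if_pos ⟨hdeg, hδi, hδf⟩, Finset.prod_eq_single u]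
        · rw [hbu]; ring
        · intro k _ hk
          rcases letters_exhaust hji hju hjf hiu hif huf k with rfl | rfl | rfl | rfl
          · rw [hγ, hbj, Nat.choose_zero_right, Nat.cast_one, one_pow, one_mul]
          · rw [hδi, hbi, Nat.choose_self, Nat.sub_self, pow_zero, Nat.cast_one, one_mul]
          · exact absurd rfl hk
          · rw [hδf, hbf, Nat.choose_self, Nat.sub_self, pow_zero, Nat.cast_one, one_mul]
        · intro h; exact absurd (Finset.mem_univ u) h
      · rw [if_neg (fun h => hδf h.2.2), Finset.prod_eq_zero (Finset.mem_univ f), mul_zero]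
        rcases Nat.lt_or_gt_of_ne hδf with hlt | hgt
        · rw [Nat.choose_eq_zero_of_lt hlt, Nat.cast_zero, zero_mul]
        · rw [hbf, zero_pow (Nat.sub_ne_zero_of_lt hgt), mul_zero]
    · rw [if_neg (fun h => hδi h.2.1), Finset.prod_eq_zero (Finset.mem_univ i), mul_zero]
      rcases Nat.lt_or_gt_of_ne hδi with hlt | hgt
      · rw [Nat.choose_eq_zero_of_lt hlt, Nat.cast_zero, zero_mul]
      · rw [hbi, zero_pow (Nat.sub_ne_zero_of_lt hgt), mul_zero]
  · rw [if_neg hdeg, if_neg (fun h => hdeg h.1)]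

end Line

/-! ## 3. The translated-step coefficient formula -/

section Step

variable [DecidableEq K]
variable {j i u f : Fin 4} (hji : j ≠ i) (hju : j ≠ u) (hjf : j ≠ f) (hiu : i ≠ u) (hif : i ≠ f) (huf : u ≠ f)
include hji hju hjf hiu hif huf

/-- **THE TRANSLATED-STEP COEFFICIENT FORMULA, every prime** (MEMO (F1)): at the slot step in the chart of `j` translated by `β`
along the free letter `u`, the coefficient of a child monomial `γ + (m − p)·e_j` (`γ_j = 0`, `p ≤ m`, not deleted by the cleaning) is
the binomial sum over the parent LINE `{δ : |δ| = m, δ_i = γ_i, δ_f = γ_f}` of `C(δ_u, γ_u) β^{δ_u − γ_u} coeff δ F` — the Hasse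
derivative of order `γ_u` at `β` of the line polynomial `Σ coeff δ F · t^{δ_u}`.  For `β = 0` only `δ_u = γ_u` survives: FILE 2's
forward law. [OURS] [cite: Hauser2010, §§F–G] [cite: CossartJannsenSaito2020, Lemma 13.2] -/
theorem coeff_step_translate_u (p : ℕ) (s : State K) (hq : ((p : ℕ) : ℕ∞) ≤ ordAlong Finset.univ s.F) (β : K)
    {m : ℕ} (hpm : p ≤ m) (γ : Fin 4 →₀ ℕ) (hγ : γ j = 0)
    (hnp : ¬ IsPthPowerExponent p (γ + Finsupp.single j (m - p))) :
    coeff (γ + Finsupp.single j (m - p))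
        (CentreBlowup.step p Finset.univ j (Function.update (0 : Fin 4 → K) u β) s).F =
      ∑ δ ∈ s.F.support with (δ.degree = m ∧ δ i = γ i ∧ δ f = γ f),
        ((δ u).choose (γ u) : K) * β ^ (δ u - γ u) * coeff δ s.F := by
  have hp : ∀ d ∈ s.F.support, p ≤ d.degree := fun d hd => by
    have h := le_trans hq (ordAlong_le_of_mem_support (S := Finset.univ) hd)
    rw [degIn_univ] at h
    exact_mod_cast h
  have hbj : Function.update (0 : Fin 4 → K) u β j = 0 := by
    rw [Function.update_of_ne hju]; rfl
  show coeff _ (deletePthPowers p (pointTransform p Finset.univ j _ s)) = _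
  rw [coeff_deletePthPowers, if_neg hnp,
    coeff_add_single_pointTransform_univ_of_le hpm j _ hbj s hp γ hγ,
    coeff_translate_line_u hji hju hjf hiu hif huf β s.F m γ hγ]

/-! ## 4. The u-row FLAG is carried by every translated slot step -/

/-- **THE FLAG IS CARRIED, any translation** (MEMO (F2); `d + 1 = p`, `2 ≤ d`, `c′ + 2 ≤ d`): under the exact pair ledger
(«`f`-degree `≤ d − 1` ⇒ `j`-exponent `≥ 2`», with `p ≤ ord` so degrees are `≥ d + 2`) the coefficient of the u-row flag monomial
`x_j² x_i² x_u^{d−1−c′} x_f^{c′}` of the child of the slot step in the chart of `j` translated by ANY `β·e_u` equals the parent's: on its line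
`{|δ| = d + 3, δ_i = 2, δ_f = c′}` every parent has `δ_j ≥ 2`, hence `δ_u ≤ d − 1 − c′`, and only `δ_u = d − 1 − c′` meets
`C(δ_u, d − 1 − c′) ≠ 0`.  So the flag vector `(FLAG(c′))_{c′ ≤ d−2}` is an invariant of every light-pair chain: flagged for ever or
flagless for ever. [OURS] [cite: Hauser2010, §§F–G] -/
theorem coeff_flag_step_translate_u (p : ℕ) [hp : Fact p.Prime] {d : ℕ} (hdp : d + 1 = p) (hd2 : 2 ≤ d) (s : State K)
    (hq : ((p : ℕ) : ℕ∞) ≤ ordAlong Finset.univ s.F) (hled : ∀ e ∈ s.F.support, e f ≤ d - 1 → 2 ≤ e j) (β : K)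
    {c' : ℕ} (hc' : c' + 2 ≤ d) :
    coeff (Finsupp.single j 2 + Finsupp.single i 2 + Finsupp.single u (d - 1 - c') + Finsupp.single f c')
        (CentreBlowup.step p Finset.univ j (Function.update (0 : Fin 4 → K) u β) s).F =
      coeff (Finsupp.single j 2 + Finsupp.single i 2 + Finsupp.single u (d - 1 - c') + Finsupp.single f c') s.F := by
  classical
  set γ : Fin 4 →₀ ℕ := Finsupp.single i 2 + Finsupp.single u (d - 1 - c') + Finsupp.single f c' with hγdef
  have hγj : γ j = 0 := by
    rw [hγdef, Finsupp.add_apply, Finsupp.add_apply, Finsupp.single_eq_of_ne hji, Finsupp.single_eq_of_ne hju,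
      Finsupp.single_eq_of_ne hjf]; simp
  have hγi : γ i = 2 := by
    rw [hγdef, Finsupp.add_apply, Finsupp.add_apply, Finsupp.single_eq_same, Finsupp.single_eq_of_ne hiu,
      Finsupp.single_eq_of_ne hif]; simp
  have hγu : γ u = d - 1 - c' := by
    rw [hγdef, Finsupp.add_apply, Finsupp.add_apply, Finsupp.single_eq_of_ne hiu.symm, Finsupp.single_eq_same,
      Finsupp.single_eq_of_ne huf, zero_add, add_zero]
  have hγf : γ f = c' := by
    rw [hγdef, Finsupp.add_apply, Finsupp.add_apply, Finsupp.single_eq_of_ne hif.symm, Finsupp.single_eq_of_ne huf.symm,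
      Finsupp.single_eq_same]; simp
  have hE : (Finsupp.single j 2 + Finsupp.single i 2 + Finsupp.single u (d - 1 - c') + Finsupp.single f c' : Fin 4 →₀ ℕ) =
      γ + Finsupp.single j (d + 3 - p) := by
    rw [hγdef, show d + 3 - p = 2 by omega]
    simp only [add_comm, add_left_comm]
  have hnp : ¬ IsPthPowerExponent p (γ + Finsupp.single j (d + 3 - p)) := by
    rw [← hE, isPthPowerExponent_iff]
    intro h
    have h2 := h i
    rw [(quad_apply hji hju hjf hiu hif huf 2 2 (d - 1 - c') c').2.1] at h2
    have := Nat.le_of_dvd (by norm_num) h2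
    have := hp.out.two_le
    omega
  rw [hE, coeff_step_translate_u hji hju hjf hiu hif huf p s hq β (by omega) γ hγj hnp]
  rw [Finset.sum_eq_single (γ + Finsupp.single j (d + 3 - p))]
  · rw [Finsupp.add_apply, Finsupp.single_eq_of_ne hju.symm, add_zero, Nat.choose_self, Nat.sub_self, pow_zero,
      Nat.cast_one, one_mul, one_mul]
  · intro δ hδ hne
    rw [Finset.mem_filter] at hδ
    obtain ⟨hmem, hdeg, hδi, hδf⟩ := hδ
    have hδj : 2 ≤ δ j := hled δ hmem (by rw [hδf, hγf]; omega)
    have hdeg' := degree_eq_quad hji hju hjf hiu hif huf δ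
    rw [hδi, hδf, hγi, hγf, hdeg] at hdeg'
    -- δ_u ≤ d − 1 − c′, and equality forces δ = the flag exponent
    rcases Nat.lt_or_ge (δ u) (γ u) with hlt | hge
    · rw [Nat.choose_eq_zero_of_lt hlt, Nat.cast_zero, zero_mul, zero_mul]
    · exfalso; apply hne
      rw [hγu] at hge
      have hδu : δ u = d - 1 - c' := by omega
      have hδj' : δ j = 2 := by omega
      rw [eq_sum_single_four hji hju hjf hiu hif huf δ, hδj', hδi, hδu, hδf, hγi, hγf, hE]
  · intro hnot
    by_cases h0 : coeff (γ + Finsupp.single j (d + 3 - p)) s.F = 0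
    · rw [h0, mul_zero]
    · exfalso
      refine hnot (Finset.mem_filter.mpr ⟨mem_support_iff.mpr h0, ?_, ?_, ?_⟩)
      · rw [← hE, degree_quad]; omega
      · rw [Finsupp.add_apply, Finsupp.single_eq_of_ne hji.symm, add_zero]
      · rw [Finsupp.add_apply, Finsupp.single_eq_of_ne hjf.symm, add_zero]

/-! ## 5. The ♯-pinning identity of the flagless branch -/

/-- **♯-PINNING IDENTITY** (MEMO §3 (VT-u♯); `d + 1 = p`, `4 ≤ d`): if every `f`-free monomial of the parent has `j`-exponent `≥ 3`
(residual `κ`-exponent `≥ 2`: «regime R» of the flagless branch, reached two steps after the first letter change) then at the slot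
step in the chart of `j` translated by `β·e_u`
`coeff (x_j³x_i³x_u^{d−3}) F′ = (d − 2)·β·coeff (x_j³x_i³x_u^{d−2}) F + coeff (x_j⁴x_i³x_u^{d−3}) F`:
the line `{|δ| = d + 4, δ_i = 3, δ_f = 0}` has only the members `δ_u = d − 2` (the ♯-flag `κ²o²u^{d−2}` of the residual, binomial
`C(d−2, d−3) = d − 2`) and `δ_u = d − 3` (the cross monomial `κ³o²u^{d−3}`).  When the left side vanishes (the child has no residual
monomial of degree `d + 1`: LAYER) and the cross is dead, `(d − 2)·β·g = 0`: a non-zero ♯-flag PINS the translation to `0`.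
[OURS] [cite: Hauser2010, §§F–G] [cite: CossartJannsenSaito2020, Thm. 3.14] -/
theorem coeff_sharp_step_translate_u (p : ℕ) {d : ℕ} (hdp : d + 1 = p) (hd4 : 4 ≤ d) (s : State K)
    (hq : ((p : ℕ) : ℕ∞) ≤ ordAlong Finset.univ s.F) (hR : ∀ e ∈ s.F.support, e f = 0 → 3 ≤ e j) (β : K) :
    coeff (Finsupp.single j 3 + Finsupp.single i 3 + Finsupp.single u (d - 3) + Finsupp.single f 0)
        (CentreBlowup.step p Finset.univ j (Function.update (0 : Fin 4 → K) u β) s).F =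
      ((d - 2 : ℕ) : K) * β *
          coeff (Finsupp.single j 3 + Finsupp.single i 3 + Finsupp.single u (d - 2) + Finsupp.single f 0) s.F +
        coeff (Finsupp.single j 4 + Finsupp.single i 3 + Finsupp.single u (d - 3) + Finsupp.single f 0) s.F := by
  classical
  set γ : Fin 4 →₀ ℕ := Finsupp.single i 3 + Finsupp.single u (d - 3) + Finsupp.single f 0 with hγdef
  have hγj : γ j = 0 := by
    rw [hγdef, Finsupp.add_apply, Finsupp.add_apply, Finsupp.single_eq_of_ne hji, Finsupp.single_eq_of_ne hju,
      Finsupp.single_eq_of_ne hjf]; simp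
  have hγi : γ i = 3 := by
    rw [hγdef, Finsupp.add_apply, Finsupp.add_apply, Finsupp.single_eq_same, Finsupp.single_eq_of_ne hiu,
      Finsupp.single_eq_of_ne hif]; simp
  have hγu : γ u = d - 3 := by
    rw [hγdef, Finsupp.add_apply, Finsupp.add_apply, Finsupp.single_eq_of_ne hiu.symm, Finsupp.single_eq_same,
      Finsupp.single_eq_of_ne huf, zero_add, add_zero]
  have hγf : γ f = 0 := by
    rw [hγdef, Finsupp.add_apply, Finsupp.add_apply, Finsupp.single_eq_of_ne hif.symm, Finsupp.single_eq_of_ne huf.symm,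
      Finsupp.single_eq_same]; simp
  have hE : (Finsupp.single j 3 + Finsupp.single i 3 + Finsupp.single u (d - 3) + Finsupp.single f 0 : Fin 4 →₀ ℕ) =
      γ + Finsupp.single j (d + 4 - p) := by
    rw [hγdef, show d + 4 - p = 3 by omega]
    simp only [add_comm, add_left_comm]
  -- the two line members
  set E₁ : Fin 4 →₀ ℕ := Finsupp.single j 3 + Finsupp.single i 3 + Finsupp.single u (d - 2) + Finsupp.single f 0 with hE₁
  set E₂ : Fin 4 →₀ ℕ := Finsupp.single j 4 + Finsupp.single i 3 + Finsupp.single u (d - 3) + Finsupp.single f 0 with hE₂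
  obtain ⟨h1j, h1i, h1u, h1f⟩ := quad_apply hji hju hjf hiu hif huf 3 3 (d - 2) 0
  obtain ⟨h2j, h2i, h2u, h2f⟩ := quad_apply hji hju hjf hiu hif huf 4 3 (d - 3) 0
  have hnp : ¬ IsPthPowerExponent p (γ + Finsupp.single j (d + 4 - p)) := by
    rw [← hE, isPthPowerExponent_iff]
    intro h
    have h3 := h i
    rw [(quad_apply hji hju hjf hiu hif huf 3 3 (d - 3) 0).2.1] at h3
    have := Nat.le_of_dvd (by norm_num) h3
    omega
  rw [hE, coeff_step_translate_u hji hju hjf hiu hif huf p s hq β (by omega) γ hγj hnp]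
  have hne : E₁ ≠ E₂ := fun h => by
    have hj' : E₁ j = E₂ j := by rw [h]
    rw [h1j, h2j] at hj'
    omega
  rw [Finset.sum_eq_add E₁ E₂ hne]
  · rw [h1u, h2u, hγu, show d - 2 - (d - 3) = 1 by omega, show d - 2 = d - 3 + 1 by omega, Nat.choose_succ_self_right,
      show d - 3 + 1 = d - 2 by omega, Nat.choose_self, Nat.sub_self, pow_one, pow_zero, Nat.cast_one, one_mul, one_mul]
  · intro δ hδ hδne
    rw [Finset.mem_filter] at hδ
    obtain ⟨hmem, hdeg, hδi, hδf⟩ := hδ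
    rw [hγi] at hδi
    rw [hγf] at hδf
    have hδj : 3 ≤ δ j := hR δ hmem hδf
    have hdeg' := degree_eq_quad hji hju hjf hiu hif huf δ
    rw [hδi, hδf, hdeg] at hdeg'
    rcases Nat.lt_or_ge (δ u) (γ u) with hlt | hge
    · rw [Nat.choose_eq_zero_of_lt hlt, Nat.cast_zero, zero_mul, zero_mul]
    · exfalso
      rw [hγu] at hge
      have hsplit : (δ j = 3 ∧ δ u = d - 2) ∨ (δ j = 4 ∧ δ u = d - 3) := by omega
      rcases hsplit with ⟨hj', hu'⟩ | ⟨hj', hu'⟩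
      · apply hδne.1
        rw [eq_sum_single_four hji hju hjf hiu hif huf δ, hj', hδi, hu', hδf]
      · apply hδne.2
        rw [eq_sum_single_four hji hju hjf hiu hif huf δ, hj', hδi, hu', hδf]
  · intro hnot
    by_cases h0 : coeff E₁ s.F = 0
    · rw [h0, mul_zero]
    · exfalso
      exact hnot (Finset.mem_filter.mpr
        ⟨mem_support_iff.mpr h0, by rw [hE₁, degree_quad]; omega, by rw [h1i, hγi], by rw [h1f, hγf]⟩)
  · intro hnot
    by_cases h0 : coeff E₂ s.F = 0
    · rw [h0, mul_zero]
    · exfalso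
      exact hnot (Finset.mem_filter.mpr
        ⟨mem_support_iff.mpr h0, by rw [hE₂, degree_quad]; omega, by rw [h2i, hγi], by rw [h2f, hγf]⟩)

end Step

end ResCone

end Summit.ResolutionOfSingularities.ResolutionOfSingularities.Theorems.PIDim4
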